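import Summits.CriticalPhenomena.PercolationContinuityZ3.Theorems.PercNearOneGluingAdditiveGluingBlockPockets
import Summits.CriticalPhenomena.PercolationContinuityZ3.Theorems.PercNearOneGluingAdditiveGluingSetObserverLemma3
import Summits.CriticalPhenomena.PercolationContinuityZ3.Theorems.PercNearOneGluingAdditiveGluingKnThm2GoodEvents
import HarnessLib

/-! # Crux `PercNearOneGluing.AdditiveGluing` (stmt-CriticalPhenomena-4576), stub `stub_goodStep` — the two-relay DRIFT theorem:
# designated goodness of a glued BLOCK against the UN-GLUED minimiser, for at most two relays

Stub-plan prover (STUB-PLAN-stub_goodStep.md §4: "the kernel `stub_blockGoodTwo` attacked at `A.card = 3` FIRST"; LEAD-STATUS-c1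
§Asks: "a proof for ONE drift step at `|A ∖ b| = 2` would be the first non-trivial drift result").  Lands
`--supports stmt-CriticalPhenomena-4576`; no definitions, no named facts.

**Theorem (`blockGood_twoRelays`).**  `μ = prodBernoulli u` on the bond configurations of `Fin n`; relays `A ⊆ {a₀, a₂, b}`
with `b, a₀, a₂ ∈ A`; `a₀` a minimiser of `μ(· ↔ b)` over `A` in the UN-GLUED graph; `S ≠ ∅` ANY block of vertices
(not even disjointness from `A` is needed), `K_S = ⋃_{s∈S} C(s)` its cluster; `sel W ∈ A` any selection.  Then
`μ(a₀ ↔ b) + μ(a₀ ↮ b, a₀ ↔ S, S ↔ b) ≤ μ(S ↔ b) + Σ_{W ∩ A = ∅} μ(K_S = W) · μ(sel W ↔ b in Wᶜ)`,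
i.e. (seat k46/`blockGrowth_glue_real_*`) `μ_{u/S}(a₀ ↔ b) ≤ μ_{u/S}(S ↔ b) + pockets` for the GLUED weighting `u/S` but
the UN-GLUED worst relay `a₀` — the kernel `hker` of `goodStep24_main` (= `stub_blockGoodTwo` for `|S| = 2`) whenever
`A.card ≤ 3` (`blockGood_cardLeThree`), for EVERY block size and with NO badness hypothesis.  Gluing may re-order the
relays ("drift"); the designated inequality survives because its kernel is Kozma–Nitzan's Lemma 3 for sandwich events
of the cluster of the observer SET `S` in the un-glued graph (`lemma3_sandwich_set`, parts I–V), where `a₀` IS the minimiser.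
Proof: pocket Markov (`blockPocket_mul_offConn`) bounds each pocket term below by `min(μ(K_S=W, a₀↔b), μ(K_S=W, a₂↔b))`;
the exchange normal form at `a₀` reduces the claim to `μ(a₀↔b, Q) ≤ μ(a₂↔b, Q)` for the sandwich event
`Q = {a₂ ∈ K_S ∌ a₀} ∪ {K_S = W : W dead, μ(K_S=W, a₂↔b) < μ(K_S=W, a₀↔b)}`.
[cite: KozmaNitzan2024, §3.2 (Definition p. 12, Question 7 p. 36), Lemma 3 (pp. 6–7)]
-/

namespace Summit.CriticalPhenomena.PercolationContinuityZ3.Theorems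

open MeasureTheory Set
open Literature.Probability.LatticeModels (prodBernoulli)
open Literature.Probability.Percolation (BondConfig openConn openConnIn openGraph openCluster)
open scoped BigOperators

noncomputable section
open Classical

section BlockGoodTwoRelays

open Literature.Probability.LatticeModels Literature.Probability.Percolation

variable {n : ℕ}

/-- **Partition of a block sandwich event by the values of `K_S`**: for `𝓕 = {T | a₂ ∈ T, a₀ ∉ T} ∪ {↑W | W ∈ R}` with
`R` a set of vertex sets avoiding `a₂`, and any event `E`,
`μ(E ∩ {K_S ∈ 𝓕}) = μ(E ∩ {a₂ ∈ K_S, a₀ ∉ K_S}) + Σ_{W ∈ R} μ({K_S = W} ∩ E)`. [folklore; Grimmett 1999 §1.3] -/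
theorem real_inter_blockSandwichFamily (u : Sym2 (Fin n) → unitInterval) (S : Finset (Fin n)) (a₀ a₂ : Fin n)
    (R : Finset (Finset (Fin n))) (hR : ∀ W ∈ R, a₂ ∉ W) (E : Set (BondConfig (Fin n))) :
    (prodBernoulli u).real (E ∩ {ω | (⋃ s ∈ S, openCluster ω s) ∈
        ({T : Set (Fin n) | a₂ ∈ T ∧ a₀ ∉ T} ∪ {T | ∃ W ∈ R, T = (W : Set (Fin n))})}) =
      (prodBernoulli u).real (E ∩ ((⋃ s ∈ S, openConn s a₂) ∩ (⋃ s ∈ S, openConn s a₀)ᶜ)) +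
        ∑ W ∈ R, (prodBernoulli u).real
          ({ω : BondConfig (Fin n) | ∀ z : Fin n, (z ∈ W ↔ ω ∈ ⋃ s ∈ S, openConn s z)} ∩ E) := by
  have hcoe : ∀ ω : BondConfig (Fin n),
      (((Finset.univ.filter fun z : Fin n => ω ∈ ⋃ s ∈ S, openConn s z : Finset (Fin n)) : Set (Fin n))) =
        ⋃ s ∈ S, openCluster ω s := by
    intro ω; ext v
    simp only [Finset.coe_filter, Finset.mem_univ, true_and, Set.mem_setOf_eq, Set.mem_iUnion, exists_prop]
    exact Iff.rfl
  have hmemf : ∀ (ω : BondConfig (Fin n)) (a : Fin n),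
      a ∈ (Finset.univ.filter fun z : Fin n => ω ∈ ⋃ s ∈ S, openConn s z) ↔ ω ∈ ⋃ s ∈ S, openConn s a :=
    fun ω a => by simp only [Finset.mem_filter, Finset.mem_univ, true_and]
  have e1 : (prodBernoulli u).real (E ∩ {ω | (⋃ s ∈ S, openCluster ω s) ∈
      ({T : Set (Fin n) | a₂ ∈ T ∧ a₀ ∉ T} ∪ {T | ∃ W ∈ R, T = (W : Set (Fin n))})}) =
      (prodBernoulli u).real (E ∩ {ω | (fun W => (a₂ ∈ W ∧ a₀ ∉ W) ∨ W ∈ R)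
        (Finset.univ.filter fun z : Fin n => ω ∈ ⋃ s ∈ S, openConn s z)}) := by
    congr 1; ext ω
    simp only [Set.mem_inter_iff, Set.mem_setOf_eq, Set.mem_union, ← hcoe, Finset.mem_coe]
    refine and_congr_right fun _ => or_congr Iff.rfl ⟨?_, fun h => ⟨_, h, rfl⟩⟩
    rintro ⟨W, hW, hWe⟩
    rwa [Finset.coe_injective hWe]
  have e2 : (prodBernoulli u).real (E ∩ ((⋃ s ∈ S, openConn s a₂) ∩ (⋃ s ∈ S, openConn s a₀)ᶜ)) =
      (prodBernoulli u).real (E ∩ {ω | (fun W => a₂ ∈ W ∧ a₀ ∉ W)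
        (Finset.univ.filter fun z : Fin n => ω ∈ ⋃ s ∈ S, openConn s z)}) := by
    congr 1; ext ω
    simp only [Set.mem_inter_iff, Set.mem_setOf_eq, Set.mem_compl_iff, hmemf]
  rw [e1, e2, blockPocket_real_eq_sum u S E (fun W => (a₂ ∈ W ∧ a₀ ∉ W) ∨ W ∈ R),
    blockPocket_real_eq_sum u S E (fun W => a₂ ∈ W ∧ a₀ ∉ W)]
  have hexcl : ∀ W, W ∈ R → ¬ (a₂ ∈ W ∧ a₀ ∉ W) := fun W hWR hW => hR W hWR hW.1
  have hR' : ∑ W ∈ R, (prodBernoulli u).real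
        ({ω : BondConfig (Fin n) | ∀ z : Fin n, (z ∈ W ↔ ω ∈ ⋃ s ∈ S, openConn s z)} ∩ E) =
      ∑ W, (if W ∈ R then (prodBernoulli u).real
        ({ω : BondConfig (Fin n) | ∀ z : Fin n, (z ∈ W ↔ ω ∈ ⋃ s ∈ S, openConn s z)} ∩ E) else 0) :=
    (Fintype.sum_ite_mem R _).symm
  rw [hR', ← Finset.sum_add_distrib]
  refine Finset.sum_congr rfl fun W _ => ?_
  by_cases hp : a₂ ∈ W ∧ a₀ ∉ W
  · have hr : W ∉ R := fun hr => hexcl W hr hp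
    simp [hp, hr]
  · by_cases hr : W ∈ R
    · simp [hp, hr]
    · simp [hp, hr]

/-- **The two-relay DRIFT theorem (designated goodness of a glued block against the un-glued minimiser).**
See the module docstring. [cite: KozmaNitzan2024, §3.2 (Definition p. 12), Lemma 3 (pp. 6–7)] -/
theorem blockGood_twoRelays (u : Sym2 (Fin n) → unitInterval) (A S : Finset (Fin n)) (b a₀ a₂ : Fin n)
    (sel : Finset (Fin n) → Fin n) (hbA : b ∈ A) (ha₀ : a₀ ∈ A) (ha₂ : a₂ ∈ A)
    (hA : ∀ a ∈ A, a = a₀ ∨ a = a₂ ∨ a = b) (hS : S.Nonempty)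
    (hsel : ∀ W, sel W ∈ A)
    (hmin : ∀ a ∈ A, (prodBernoulli u).real (openConn a₀ b) ≤ (prodBernoulli u).real (openConn a b)) :
    (prodBernoulli u).real (openConn a₀ b)
        + (prodBernoulli u).real
            ((openConn a₀ b)ᶜ ∩ (⋃ s ∈ S, openConn a₀ s) ∩ (⋃ s ∈ S, openConn s b))
      ≤ (prodBernoulli u).real (⋃ s ∈ S, openConn s b)
        + ∑ W ∈ (Finset.univ : Finset (Finset (Fin n))).filter (fun W => Disjoint W A),
            (prodBernoulli u).real {ω : BondConfig (Fin n) | ∀ z : Fin n, (z ∈ W ↔ ω ∈ ⋃ s ∈ S, openConn s z)}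
              * (prodBernoulli u).real (openConnIn ((W : Set (Fin n))ᶜ) (sel W) b) := by
  set μ := prodBernoulli u with hμ
  have hms : ∀ s : Set (BondConfig (Fin n)), MeasurableSet s := fun _ => MeasurableSet.of_discrete
  -- notation
  set KW : Finset (Fin n) → Set (BondConfig (Fin n)) :=
    fun W => {ω : BondConfig (Fin n) | ∀ z : Fin n, (z ∈ W ↔ ω ∈ ⋃ s ∈ S, openConn s z)} with hKW
  set Y : Set (BondConfig (Fin n)) := ⋃ s ∈ S, openConn s b with hY
  set Xs : Set (BondConfig (Fin n)) := ⋃ s ∈ S, openConn a₀ s with hXs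
  set A2 : Set (BondConfig (Fin n)) := ⋃ s ∈ S, openConn s a₂ with hA2
  set 𝒟 : Finset (Finset (Fin n)) := (Finset.univ : Finset (Finset (Fin n))).filter (fun W => Disjoint W A) with h𝒟
  set f₀ : Finset (Fin n) → ℝ := fun W => μ.real (KW W ∩ openConn a₀ b) with hf₀
  set f₂ : Finset (Fin n) → ℝ := fun W => μ.real (KW W ∩ openConn a₂ b) with hf₂
  have hXs' : Xs = ⋃ s ∈ S, openConn s a₀ := by
    simp only [hXs, knThm2_openConn_comm a₀]
  have hmemXs : ∀ ω, ω ∈ Xs ↔ ∃ s ∈ S, (openGraph ω).Reachable a₀ s := fun ω => by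
    simp only [hXs, Set.mem_iUnion, exists_prop]; exact Iff.rfl
  have hmemY : ∀ ω, ω ∈ Y ↔ ∃ s ∈ S, (openGraph ω).Reachable s b := fun ω => by
    simp only [hY, Set.mem_iUnion, exists_prop]; exact Iff.rfl
  have hmemA2 : ∀ ω, ω ∈ A2 ↔ ∃ s ∈ S, (openGraph ω).Reachable s a₂ := fun ω => by
    simp only [hA2, Set.mem_iUnion, exists_prop]; exact Iff.rfl
  have hmem𝒟 : ∀ W, W ∈ 𝒟 ↔ Disjoint W A := fun W => by simp [h𝒟]
  -- (S1) each pocket term is at least `min(f₀, f₂)`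
  have hterm : ∀ W ∈ 𝒟, min (f₀ W) (f₂ W) ≤ μ.real (KW W) * μ.real (openConnIn ((W : Set (Fin n))ᶜ) (sel W) b) := by
    intro W hW
    have hWA : Disjoint W A := (hmem𝒟 W).1 hW
    have hselW : sel W ∉ W := fun h => Finset.disjoint_left.1 hWA h (hsel W)
    rw [show μ.real (KW W) * μ.real (openConnIn ((W : Set (Fin n))ᶜ) (sel W) b) = μ.real (KW W ∩ openConn (sel W) b)
      from blockPocket_mul_offConn u S W hS (sel W) b hselW]
    rcases hA (sel W) (hsel W) with h | h | h
    · rw [h]; exact min_le_left _ _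
    · rw [h]; exact min_le_right _ _
    · rw [h]
      refine (min_le_left _ _).trans (measureReal_mono (Set.inter_subset_inter_right _ fun ω _ => ?_) (measure_ne_top _ _))
      exact (SimpleGraph.Reachable.refl b : (openGraph ω).Reachable b b)
  have hsum1 : ∑ W ∈ 𝒟, min (f₀ W) (f₂ W) ≤
      ∑ W ∈ 𝒟, μ.real (KW W) * μ.real (openConnIn ((W : Set (Fin n))ᶜ) (sel W) b) := Finset.sum_le_sum hterm
  -- (S2) the dead part of `τ(a₀)` is the fibre sum of `f₀`
  have hP3 : μ.real (openConn a₀ b ∩ Yᶜ ∩ A2ᶜ) = ∑ W ∈ 𝒟, f₀ W := by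
    have h := blockPocket_sum_dead u S A (openConn a₀ b)
    simp only [hf₀, h𝒟, hKW]
    rw [h]
    congr 1; ext ω
    simp only [Set.mem_inter_iff, Set.mem_compl_iff, Set.mem_setOf_eq, hmemY, hmemA2, Set.mem_iUnion, exists_prop,
      not_exists, not_and]
    constructor
    · rintro ⟨⟨hab, hYc⟩, hA2c⟩
      refine ⟨hab, fun a ha s hs hsa => ?_⟩
      rcases hA a ha with rfl | rfl | rfl
      · exact hYc s hs (hsa.trans hab)
      · exact hA2c s hs hsa
      · exact hYc s hs hsa
    · rintro ⟨hab, hdead⟩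
      exact ⟨⟨hab, fun s hs hsb => hdead b hbA s hs hsb⟩, fun s hs hsa => hdead a₂ ha₂ s hs hsa⟩
  -- (S3) `τ(a₀) = P1 + P2 + P3`
  have hτ : μ.real (openConn a₀ b) = μ.real (openConn a₀ b ∩ Y) + μ.real (openConn a₀ b ∩ Yᶜ ∩ A2)
      + μ.real (openConn a₀ b ∩ Yᶜ ∩ A2ᶜ) := by
    have e1 := measureReal_inter_add_sdiff (μ := μ) (s := openConn a₀ b) (hms Y) (measure_ne_top _ _)
    have e2 := measureReal_inter_add_sdiff (μ := μ) (s := openConn a₀ b ∩ Yᶜ) (hms A2) (measure_ne_top _ _)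
    rw [Set.sdiff_eq] at e1 e2
    linarith
  -- (S4) `μ(Y) = Q1 + Q2 + Q3`
  have hYd : μ.real Y = μ.real (openConn a₀ b ∩ Y)
      + μ.real ((openConn a₀ b)ᶜ ∩ Xs ∩ Y) + μ.real (Y ∩ (openConn a₀ b)ᶜ ∩ Xsᶜ) := by
    have e1 := measureReal_inter_add_sdiff (μ := μ) (s := Y) (hms (openConn a₀ b)) (measure_ne_top _ _)
    have e2 := measureReal_inter_add_sdiff (μ := μ) (s := Y ∩ (openConn a₀ b)ᶜ) (hms Xs) (measure_ne_top _ _)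
    rw [Set.sdiff_eq] at e1 e2
    rw [Set.inter_comm Y (openConn a₀ b)] at e1
    have e3 : Y ∩ (openConn a₀ b)ᶜ ∩ Xs = (openConn a₀ b)ᶜ ∩ Xs ∩ Y := by
      ext ω; simp only [Set.mem_inter_iff]; tauto
    rw [e3] at e2
    linarith
  -- (S5) `Q3 ≥ μ(a₂↔b, a₂ ∈ K_S, a₀ ∉ K_S)`
  have hQ3 : μ.real (openConn a₂ b ∩ (A2 ∩ Xsᶜ)) ≤ μ.real (Y ∩ (openConn a₀ b)ᶜ ∩ Xsᶜ) := by
    refine measureReal_mono (fun ω hω => ?_) (measure_ne_top _ _)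
    simp only [Set.mem_inter_iff, Set.mem_compl_iff, hmemY, hmemA2, hmemXs, not_exists, not_and] at hω ⊢
    obtain ⟨h2b, ⟨s, hs, hs2⟩, hXc⟩ := hω
    refine ⟨⟨⟨s, hs, hs2.trans h2b⟩, fun hab => hXc s hs ?_⟩, hXc⟩
    exact (show (openGraph ω).Reachable a₀ b from hab).trans (hs2.trans h2b).symm
  -- (S6) `P2 ≤ μ(a₀↔b, a₂ ∈ K_S, a₀ ∉ K_S)`
  have hP2 : μ.real (openConn a₀ b ∩ Yᶜ ∩ A2) ≤ μ.real (openConn a₀ b ∩ (A2 ∩ Xsᶜ)) := by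
    refine measureReal_mono (fun ω hω => ?_) (measure_ne_top _ _)
    simp only [Set.mem_inter_iff, Set.mem_compl_iff, hmemY, hmemA2, hmemXs, not_exists, not_and] at hω ⊢
    obtain ⟨⟨hab, hYc⟩, hA2ω⟩ := hω
    exact ⟨hab, hA2ω, fun s hs h0s => hYc s hs (h0s.symm.trans hab)⟩
  -- (S7) Lemma 3 for the observer set `S` and the sandwich family
  set R : Finset (Finset (Fin n)) := 𝒟.filter (fun W => f₂ W < f₀ W) with hR
  have hRA : ∀ W ∈ R, Disjoint W A := fun W hW => (hmem𝒟 W).1 (Finset.mem_filter.1 hW).1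
  have hRa₂ : ∀ W ∈ R, a₂ ∉ W := fun W hW h => Finset.disjoint_left.1 (hRA W hW) h ha₂
  set 𝓕 : Set (Set (Fin n)) := {T : Set (Fin n) | a₂ ∈ T ∧ a₀ ∉ T} ∪ {T | ∃ W ∈ R, T = (W : Set (Fin n))} with h𝓕
  have hlo : ∀ ω : BondConfig (Fin n), a₂ ∈ (⋃ s ∈ S, openCluster ω s) → a₀ ∉ (⋃ s ∈ S, openCluster ω s) →
      (⋃ s ∈ S, openCluster ω s) ∈ 𝓕 := fun ω h2 h0 => Or.inl ⟨h2, h0⟩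
  have hhi : ∀ ω : BondConfig (Fin n), (⋃ s ∈ S, openCluster ω s) ∈ 𝓕 → a₀ ∉ (⋃ s ∈ S, openCluster ω s) := by
    rintro ω (⟨-, h0⟩ | ⟨W, hW, hWe⟩)
    · exact h0
    · rw [hWe]
      exact fun h => Finset.disjoint_left.1 (hRA W hW) (Finset.mem_coe.1 h) ha₀
  have hsand := SandwichSet.lemma3_sandwich_set u a₀ a₂ b S 𝓕 hlo hhi (hmin a₂ ha₂)
  have hpart₀ := real_inter_blockSandwichFamily u S a₀ a₂ R hRa₂ (openConn a₀ b)
  have hpart₂ := real_inter_blockSandwichFamily u S a₀ a₂ R hRa₂ (openConn a₂ b)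
  -- the sandwich event's "bottom" `{a₂ ∈ K_S, a₀ ∉ K_S}` is `A2 ∩ Xsᶜ`
  have hbot : ((⋃ s ∈ S, openConn s a₂) ∩ (⋃ s ∈ S, openConn s a₀)ᶜ : Set (BondConfig (Fin n))) = A2 ∩ Xsᶜ := by
    rw [hXs']
  rw [hbot] at hpart₀ hpart₂
  rw [hpart₀, hpart₂] at hsand
  -- `hsand : μ(a₀b ∩ (A2 ∩ Xsᶜ)) + Σ_R f₀ ≤ μ(a₂b ∩ (A2 ∩ Xsᶜ)) + Σ_R f₂`
  -- (S8) `Σ_𝒟 f₀ = Σ_𝒟 min(f₀,f₂) + Σ_R (f₀ − f₂)`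
  have hS8 : ∑ W ∈ 𝒟, f₀ W = ∑ W ∈ 𝒟, min (f₀ W) (f₂ W) + (∑ W ∈ R, f₀ W - ∑ W ∈ R, f₂ W) := by
    have hpt : ∀ W, f₀ W = min (f₀ W) (f₂ W) + (if f₂ W < f₀ W then f₀ W - f₂ W else 0) := by
      intro W
      by_cases hlt : f₂ W < f₀ W
      · rw [if_pos hlt, min_eq_right hlt.le]; ring
      · rw [if_neg hlt, min_eq_left (not_lt.1 hlt)]; ring
    have hRsum : ∑ W ∈ R, f₀ W - ∑ W ∈ R, f₂ W = ∑ W ∈ 𝒟, (if f₂ W < f₀ W then f₀ W - f₂ W else 0) := by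
      rw [← Finset.sum_sub_distrib, hR, Finset.sum_filter]
    rw [hRsum, ← Finset.sum_add_distrib]
    exact Finset.sum_congr rfl fun W _ => hpt W
  -- combine
  have hsumR₀ : ∑ W ∈ R, μ.real ({ω : BondConfig (Fin n) | ∀ z : Fin n, (z ∈ W ↔ ω ∈ ⋃ s ∈ S, openConn s z)} ∩
      openConn a₀ b) = ∑ W ∈ R, f₀ W := rfl
  have hsumR₂ : ∑ W ∈ R, μ.real ({ω : BondConfig (Fin n) | ∀ z : Fin n, (z ∈ W ↔ ω ∈ ⋃ s ∈ S, openConn s z)} ∩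
      openConn a₂ b) = ∑ W ∈ R, f₂ W := rfl
  rw [hsumR₀, hsumR₂] at hsand
  simp only [hKW, h𝒟] at hsum1
  linarith [hsum1, hP3, hτ, hYd, hQ3, hP2, hsand, hS8]

/-- **Block goodness against the un-glued minimiser for `A.card ≤ 3`** (the kernel `hker` of `goodStep24_main` for every
block size, in particular `stub_blockGoodTwo`, whenever there are at most two relays besides the target): for `b, a₀ ∈ A`,
`A.card ≤ 3`, `a₀` a minimiser of `μ(· ↔ b)` over `A`, any block `S ≠ ∅` and any selection `sel W ∈ A`,
`μ(a₀↔b) + μ(a₀↮b, a₀↔S, S↔b) ≤ μ(S↔b) + Σ_{W∩A=∅} μ(K_S = W)·μ(sel W ↔ b in Wᶜ)`.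
[cite: KozmaNitzan2024, §3.2 (Definition p. 12), Lemma 3 (pp. 6–7)] -/
theorem blockGood_cardLeThree (u : Sym2 (Fin n) → unitInterval) (A S : Finset (Fin n)) (b a₀ : Fin n)
    (sel : Finset (Fin n) → Fin n) (hbA : b ∈ A) (ha₀ : a₀ ∈ A) (hA3 : A.card ≤ 3)
    (hS : S.Nonempty) (hsel : ∀ W, sel W ∈ A)
    (hmin : ∀ a ∈ A, (prodBernoulli u).real (openConn a₀ b) ≤ (prodBernoulli u).real (openConn a b)) :
    (prodBernoulli u).real (openConn a₀ b)
        + (prodBernoulli u).real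
            ((openConn a₀ b)ᶜ ∩ (⋃ s ∈ S, openConn a₀ s) ∩ (⋃ s ∈ S, openConn s b))
      ≤ (prodBernoulli u).real (⋃ s ∈ S, openConn s b)
        + ∑ W ∈ (Finset.univ : Finset (Finset (Fin n))).filter (fun W => Disjoint W A),
            (prodBernoulli u).real {ω : BondConfig (Fin n) | ∀ z : Fin n, (z ∈ W ↔ ω ∈ ⋃ s ∈ S, openConn s z)}
              * (prodBernoulli u).real (openConnIn ((W : Set (Fin n))ᶜ) (sel W) b) := by
  by_cases hab : a₀ = b
  · -- the designated relay is the target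
    subst hab
    have hbb : (openConn a₀ a₀ : Set (BondConfig (Fin n))) = Set.univ :=
      Set.eq_univ_of_forall fun ω => (SimpleGraph.Reachable.refl a₀ : (openGraph ω).Reachable a₀ a₀)
    have h0 : (prodBernoulli u).real ((openConn a₀ a₀)ᶜ ∩ (⋃ s ∈ S, openConn a₀ s) ∩ (⋃ s ∈ S, openConn s a₀)) = 0 := by
      rw [hbb, Set.compl_univ, Set.empty_inter, Set.empty_inter, measureReal_empty]
    rw [h0, add_zero, hbb, probReal_univ]
    exact blockGood_of_target_min u A S a₀ sel hS hsel hmin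
  · -- name the (at most one) relay besides `a₀` and `b`
    set A' : Finset (Fin n) := (A.erase a₀).erase b with hA'
    have hcard : A'.card ≤ 1 := by
      have h1 : (A.erase a₀).card = A.card - 1 := Finset.card_erase_of_mem ha₀
      have hb' : b ∈ A.erase a₀ := Finset.mem_erase.2 ⟨fun h => hab h.symm, hbA⟩
      have h2 : A'.card = (A.erase a₀).card - 1 := Finset.card_erase_of_mem hb'
      omega
    have hmemA' : ∀ a, a ∈ A' ↔ a ∈ A ∧ a ≠ a₀ ∧ a ≠ b := fun a => by
      simp only [hA', Finset.mem_erase]; tauto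
    obtain ⟨a₂, ha₂, hA⟩ : ∃ a₂ ∈ A, ∀ a ∈ A, a = a₀ ∨ a = a₂ ∨ a = b := by
      rcases A'.eq_empty_or_nonempty with he | ⟨a₂, ha₂'⟩
      · refine ⟨a₀, ha₀, fun a ha => ?_⟩
        by_cases h1 : a = a₀
        · exact Or.inl h1
        by_cases h2 : a = b
        · exact Or.inr (Or.inr h2)
        have : a ∈ A' := (hmemA' a).2 ⟨ha, h1, h2⟩
        rw [he] at this
        exact absurd this (Finset.notMem_empty a)
      · refine ⟨a₂, ((hmemA' a₂).1 ha₂').1, fun a ha => ?_⟩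
        by_cases h1 : a = a₀
        · exact Or.inl h1
        by_cases h2 : a = b
        · exact Or.inr (Or.inr h2)
        have haA' : a ∈ A' := (hmemA' a).2 ⟨ha, h1, h2⟩
        exact Or.inr (Or.inl (Finset.card_le_one.1 hcard a haA' a₂ ha₂'))
    exact blockGood_twoRelays u A S b a₀ a₂ sel hbA ha₀ ha₂ hA hS hsel hmin

/-- **`stub_blockGoodTwo` for `A.card ≤ 3`** — the registered two-vertex kernel of `stub_goodStep` (STUB-PLAN H4, verbatim
conclusion and hypotheses) whenever there are at most two relays besides the target; the badness hypotheses are not needed.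
[cite: KozmaNitzan2024, §3.2 (Definition p. 12), Lemma 3 (pp. 6–7)] -/
theorem blockGoodTwo_cardLeThree :
    ∀ (n : ℕ) (u : Sym2 (Fin n) → unitInterval) (A : Finset (Fin n)) (b a₀ v u₁ : Fin n)
      (sel : Finset (Fin n) → Fin n),
      b ∈ A → a₀ ∈ A → A.card ≤ 3 → v ∉ A → u₁ ∉ A → v ≠ u₁ → (∀ W, sel W ∈ A) →
      (∀ a ∈ A, (prodBernoulli u).real (openConn a₀ b) ≤ (prodBernoulli u).real (openConn a b)) →
      (prodBernoulli u).real (openConn v b) < (prodBernoulli u).real (openConn a₀ b) →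
      (prodBernoulli u).real (openConn u₁ b) < (prodBernoulli u).real (openConn a₀ b) →
      (prodBernoulli u).real (openConn a₀ b)
          + (prodBernoulli u).real ((openConn a₀ b)ᶜ ∩ (openConn a₀ v ∪ openConn a₀ u₁)
              ∩ (openConn v b ∪ openConn u₁ b))
        ≤ (prodBernoulli u).real (openConn v b ∪ openConn u₁ b)
          + ∑ W' ∈ (Finset.univ : Finset (Finset (Fin n))).filter (fun W' => Disjoint W' A),
              (prodBernoulli u).real
                  {ω : BondConfig (Fin n) | ∀ z : Fin n, (z ∈ W' ↔ ω ∈ openConn v z ∪ openConn u₁ z)}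
                * (prodBernoulli u).real (openConnIn ((W' : Set (Fin n))ᶜ) (sel W') b) := by
  intro n u A b a₀ v u₁ sel hbA ha₀ hA3 _ _ _ hsel hmin _ _
  have h := blockGood_cardLeThree u A {v, u₁} b a₀ sel hbA ha₀ hA3 ⟨v, Finset.mem_insert_self v {u₁}⟩ hsel hmin
  simp only [blockGrowth_biUnion_pair_left, blockGrowth_biUnion_pair_right] at h
  exact h

end BlockGoodTwoRelays

open Literature.Probability.LatticeModels Literature.Probability.Percolation in
/-- Registered helper stub `stub_blockGoodCardLeThree_sp` (stub-plan prover): **the two-relay drift theorem** — block goodness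
against the UN-GLUED minimiser for every block `S ≠ ∅` whenever `A.card ≤ 3` (= `blockGood_cardLeThree`; the kernel `hker` of
`goodStep24_main` / `stub_blockGoodTwo` at `A.card ≤ 3`). [cite: KozmaNitzan2024, §3.2 (Definition p. 12, Question 7 p. 36), Lemma 3 (pp. 6–7)] -/
theorem stub_blockGoodCardLeThree_sp : ∀ (n : ℕ) (u : Sym2 (Fin n) → unitInterval) (A S : Finset (Fin n)) (b a₀ : Fin n) (sel : Finset (Fin n) → Fin n), b ∈ A → a₀ ∈ A → A.card ≤ 3 → S.Nonempty → (∀ W, sel W ∈ A) → (∀ a ∈ A, (prodBernoulli u).real (openConn a₀ b) ≤ (prodBernoulli u).real (openConn a b)) → (prodBernoulli u).real (openConn a₀ b) + (prodBernoulli u).real ((openConn a₀ b)ᶜ ∩ (⋃ s ∈ S, openConn a₀ s) ∩ (⋃ s ∈ S, openConn s b)) ≤ (prodBernoulli u).real (⋃ s ∈ S, openConn s b) + ∑ W ∈ (Finset.univ : Finset (Finset (Fin n))).filter (fun W => Disjoint W A), (prodBernoulli u).real {ω : BondConfig (Fin n) | ∀ z : Fin n, (z ∈ W ↔ ω ∈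 ⋃ s ∈ S, openConn s z)} * (prodBernoulli u).real (openConnIn ((W : Set (Fin n))ᶜ) (sel W) b) :=
  fun _ u A S b a₀ sel hbA ha₀ hA3 hS hsel hmin => blockGood_cardLeThree u A S b a₀ sel hbA ha₀ hA3 hS hsel hmin

end

end Summit.CriticalPhenomena.PercolationContinuityZ3.Theorems
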